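import Literature.Analysis.FluidPDE.TorusVorticitySqTransport
import Literature.Analysis.FunctionSpaces.TorusSpaceTimeComposition
import HarnessLib

/-!
# Weighted vorticity balances `d/dt ∫ Φ(|ω|²)` along classical Navier–Stokes solutions on `T^d`

Analysis/FluidPDE proof file (theorems only). For a classical solution `(u, p)` of
`∂ₜu + (u·∇)u = νΔu − ∇p + f`, `div u = 0` on `T^d × [a, b]` and a weight `Φ` smooth on an open
set `U ⊆ ℝ` containing every value `|ω(s, x)|²`, `s ∈ [a, b]`:

`d/dt ∫ Φ(|ω|²) = 2∫ Φ'(|ω|²) σ − ν (∫ Φ'(|ω|²) ∑ₖ∑ᵢⱼ (∂ₖWᵢⱼ)² + ∫ Φ''(|ω|²) ∑ₖ (∂ₖ|ω|²)²) + ∫ Φ'(|ω|²) ∑ᵢⱼ Wᵢⱼ(∂ᵢfⱼ − ∂ⱼfᵢ)`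

(one-sided derivative within `[a, b]`; `σ = torusStretchingDensity`, `= ω·𝒟ω` on `T³`):
differentiate under `∫_{T^d}` (`Torus.IsSmoothSpaceTimeOn.hasDerivWithinAt_integral`), insert the
transport identity for `|ω|²`, drop `∫ (u·∇)Φ(|ω|²) = 0` and integrate the viscous term by parts
(`TorusVorticitySqTransport`). With `Φ(s) = sᵐ` on `T³` this is the opening identity of Gibbon 2010,
App. A (proof of Prop. 1): `(1/2m) J̇ₘ = ∫ |ω|^{2(m−1)} ω·(νΔω + (ω·∇)u + curl f)`, `Jₘ = ∫|ω|^{2m}`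
(power form and sign corollaries: `TorusVorticityMomentBalance`); a general smooth `Φ` (regularised
powers `(s + ε)^{q/2}`, log-weights, …) is the same computation.

* `IsClassicalNSSolutionOn.hasDerivWithinAt_integral_comp_torusVorticitySqAt` — the balance.

## References

* A. J. Majda, A. L. Bertozzi, *Vorticity and Incompressible Flow*, CUP 2002, §1.4 (1.18)–(1.21)
  (`𝒟`, `Ω`, `ω`, `Ωh = ½ω × h`), proof of Prop. 1.5: (1.29) `DV/Dt + V² = −P + νΔV`, (1.31)
  `DΩ/Dt + Ω𝒟 + 𝒟Ω = νΔΩ`, (1.32) `Dω/Dt = 𝒟ω + νΔω` (held: book:majda2002-vorticity-incompressible-flow,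
  chunks 15, 18–19). [MajdaBertozziCUP2002]
* J. D. Gibbon, *Regularity and singularity in solutions of the three-dimensional Navier–Stokes
  equations*, Proc. R. Soc. A 466 (2010) 2587–2604, doi:10.1098/rspa.2009.0642; §2 (definition
  `Jₘ = ∫|ω|^{2m} dV` on the periodic box `[0, L]³`) and Appendix A (proof of Prop. 1): the first
  display is `(1/2m) J̇ₘ = ∫ |ω|^{2(m−1)} ω·{νΔω + ω·∇u + curl f} dV`, step 1 bounds the Laplacian
  term by `−(2(m−1)/m²)∫|∇(|ω|ᵐ)|²` (held: paper:arxiv-0905.0344, chunks 5–6, 9). [Gibbon2010]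
* C. R. Doering, J. D. Gibbon, *Applied Analysis of the Navier–Stokes Equations*, CUP 1995, §6.5
  (6.5.18). [DoeringGibbon1995]
-/

noncomputable section

open Set MeasureTheory Finset
open scoped ContDiff InnerProductSpace RealInnerProductSpace

namespace Literature.Analysis.FluidPDE

open Literature.Analysis.FunctionSpaces

variable {d : Type*} [Fintype d] [DecidableEq d]

/-- `|ω(x)|² = ½ ∑ᵢⱼ Wᵢⱼ(x)²` (definitional). [folklore] -/
private theorem torusVorticitySqAt_eq_half_sum_sq'' (v : UnitAddTorus d → EuclideanSpace ℝ d)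
    (x : UnitAddTorus d) :
    torusVorticitySqAt v x = 2⁻¹ * ∑ i, ∑ j, torusVorticityTensor v i j x ^ 2 := rfl

/-- `Wᵢⱼ` of a smooth field is smooth. [folklore] -/
private theorem isSmooth_torusVorticityTensor'' {v : UnitAddTorus d → EuclideanSpace ℝ d}
    (hv : Torus.IsSmooth v) (i j : d) : Torus.IsSmooth (torusVorticityTensor v i j) :=
  ((hv.partialDeriv i).apply j).sub ((hv.partialDeriv j).apply i)

/-- `|ω|²` of a smooth field is smooth. [folklore] -/
private theorem isSmooth_torusVorticitySqAt' {v : UnitAddTorus d → EuclideanSpace ℝ d}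
    (hv : Torus.IsSmooth v) : Torus.IsSmooth (torusVorticitySqAt v) := by
  have h : ∀ i j, Torus.IsSmooth (fun y => torusVorticityTensor v i j y ^ 2) := fun i j => by
    have := isSmooth_torusVorticityTensor'' hv i j
    exact this.pow 2
  have hl : Torus.lift (torusVorticitySqAt v) =
      fun z => (2⁻¹ : ℝ) * ∑ i, ∑ j, Torus.lift (fun y => torusVorticityTensor v i j y ^ 2) z := by
    funext z; rfl
  unfold Torus.IsSmooth at h ⊢
  rw [hl]
  exact contDiff_const.mul (ContDiff.sum fun i _ => ContDiff.sum fun j _ => h i j)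

/-- Along a jointly smooth `u` on `[a, b] × T^d`, `(s, y) ↦ Wᵢⱼ(u(s))(y)` is jointly smooth. [folklore] -/
private theorem isSmoothSpaceTimeOn_torusVorticityTensor' {a b : ℝ}
    {u : ℝ → UnitAddTorus d → EuclideanSpace ℝ d} (hu : Torus.IsSmoothSpaceTimeOn (Icc a b) u)
    (hab : a < b) (i j : d) :
    Torus.IsSmoothSpaceTimeOn (Icc a b) (fun s y => torusVorticityTensor (u s) i j y) :=
  ((hu.partialDeriv (uniqueDiffOn_Icc hab) i).apply j).sub
    ((hu.partialDeriv (uniqueDiffOn_Icc hab) j).apply i)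

/-- Along a jointly smooth `u` on `[a, b] × T^d`, `(s, y) ↦ |ω(u(s))(y)|²` is jointly smooth. [folklore] -/
private theorem isSmoothSpaceTimeOn_torusVorticitySqAt' {a b : ℝ}
    {u : ℝ → UnitAddTorus d → EuclideanSpace ℝ d} (hu : Torus.IsSmoothSpaceTimeOn (Icc a b) u)
    (hab : a < b) :
    Torus.IsSmoothSpaceTimeOn (Icc a b) (fun s y => torusVorticitySqAt (u s) y) := by
  have h : ∀ i j, Torus.IsSmoothSpaceTimeOn (Icc a b)
      (fun s y => torusVorticityTensor (u s) i j y * torusVorticityTensor (u s) i j y) :=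
    fun i j => (isSmoothSpaceTimeOn_torusVorticityTensor' hu hab i j).mul
      (isSmoothSpaceTimeOn_torusVorticityTensor' hu hab i j)
  have hs := Torus.IsSmoothSpaceTimeOn.sum (s := Finset.univ) fun i (_ : i ∈ Finset.univ) =>
    Torus.IsSmoothSpaceTimeOn.sum (s := Finset.univ) fun j (_ : j ∈ Finset.univ) => h i j
  have hfun : (fun s y => torusVorticitySqAt (u s) y) = fun s y => (2⁻¹ : ℝ) •
      ∑ i, ∑ j, torusVorticityTensor (u s) i j y * torusVorticityTensor (u s) i j y := by
    funext s y
    rw [torusVorticitySqAt_eq_half_sum_sq'', smul_eq_mul]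
    congr 1
    exact Finset.sum_congr rfl fun i _ => Finset.sum_congr rfl fun j _ => by ring
  rw [hfun]
  exact hs.const_smul (2⁻¹ : ℝ)


omit [DecidableEq d] in
/-- Smoothness of `g ∘ θ` for `g` smooth on a set containing the values of the smooth `θ`. [folklore] -/
private theorem isSmooth_comp' {g : ℝ → ℝ} {U : Set ℝ} (hg : ContDiffOn ℝ ∞ g U)
    {θ : UnitAddTorus d → ℝ} (hθ : Torus.IsSmooth θ) (hmaps : ∀ x, θ x ∈ U) :
    Torus.IsSmooth (fun y => g (θ y)) :=
  hg.comp_contDiff hθ fun _ => hmaps _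

/-- `σ` of a smooth field is smooth. [folklore] -/
private theorem isSmooth_torusStretchingDensity {v : UnitAddTorus d → EuclideanSpace ℝ d}
    (hv : Torus.IsSmooth v) : Torus.IsSmooth (torusStretchingDensity v) := by
  have hD : ∀ i k, Torus.IsSmooth (fun y => Torus.partialDeriv i v y k) := fun i k => (hv.partialDeriv i).apply k
  have h : ∀ i j k, Torus.IsSmooth (fun y => torusVorticityTensor v i j y *
      (Torus.partialDeriv i v y k * Torus.partialDeriv k v y j)) :=
    fun i j k => (isSmooth_torusVorticityTensor'' hv i j).mul ((hD i k).mul (hD k j))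
  have hl : Torus.lift (torusStretchingDensity v) = fun z => -∑ i, ∑ j, ∑ k, Torus.lift
      (fun y => torusVorticityTensor v i j y * (Torus.partialDeriv i v y k * Torus.partialDeriv k v y j)) z := by
    funext z
    simp only [Torus.lift_apply, torusStretchingDensity, Finset.mul_sum]
  unfold Torus.IsSmooth at h ⊢
  rw [hl]
  exact (ContDiff.sum fun i _ => ContDiff.sum fun j _ => ContDiff.sum fun k _ => h i j k).neg

omit [DecidableEq d] in
/-- Double finite sums of smooth scalar functions on the torus are smooth. [folklore] -/
private theorem isSmooth_sum₂ {g : d → d → UnitAddTorus d → ℝ} (hg : ∀ i j, Torus.IsSmooth (g i j)) :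
    Torus.IsSmooth (fun y => ∑ i, ∑ j, g i j y) := by
  have hl : Torus.lift (fun y => ∑ i, ∑ j, g i j y) = fun z => ∑ i, ∑ j, Torus.lift (g i j) z := by
    funext z; simp only [Torus.lift_apply]
  unfold Torus.IsSmooth at hg ⊢
  rw [hl]
  exact ContDiff.sum fun i _ => ContDiff.sum fun j _ => hg i j

omit [DecidableEq d] in
/-- Finite sums of smooth scalar functions on the torus are smooth. [folklore] -/
private theorem isSmooth_sum₁ {g : d → UnitAddTorus d → ℝ} (hg : ∀ i, Torus.IsSmooth (g i)) :
    Torus.IsSmooth (fun y => ∑ i, g i y) := by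
  have hl : Torus.lift (fun y => ∑ i, g i y) = fun z => ∑ i, Torus.lift (g i) z := by
    funext z; simp only [Torus.lift_apply]
  unfold Torus.IsSmooth at hg ⊢
  rw [hl]
  exact ContDiff.sum fun i _ => hg i

/-- **The weighted vorticity balance along classical Navier–Stokes solutions on `T^d`**
(Gibbon 2010, App. A, proof of Prop. 1, opening identity
`(1/2m) J̇ₘ = ∫ |ω|^{2(m−1)} ω·{νΔω + ω·∇u + curl f} dV`, `Jₘ = ∫|ω|^{2m} dV` on the periodic box,
here for a general smooth weight `Φ` in place of `sᵐ` and with the Laplacian term integrated by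
parts exactly). Let `(u, p)` be a classical solution of `∂ₜu + (u·∇)u = νΔu − ∇p + f`, `div u = 0`
on `T^d × [a, b]` (`a < b`), and let `Φ` be `C^∞` on an open set `U ⊆ ℝ` containing every value
`|ω(s, x)|²`, `s ∈ [a, b]`. Then `s ↦ ∫ Φ(|ω(s)|²)` has, at every `t ∈ [a, b]`, the one-sided
derivative

`2 ∫ Φ'(|ω|²) σ − ν (∫ Φ'(|ω|²) ∑ₖ∑ᵢⱼ (∂ₖWᵢⱼ)² + ∫ Φ''(|ω|²) ∑ₖ (∂ₖ|ω|²)²) + ∫ Φ'(|ω|²) ∑ᵢⱼ Wᵢⱼ(∂ᵢfⱼ − ∂ⱼfᵢ)`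

within `[a, b]` (`σ = torusStretchingDensity`, `= ω·𝒟ω` on `T³`; in `d = 3`,
`∑ᵢⱼ WᵢⱼΔWᵢⱼ = 2ω·Δω`, `∑ₖ∑ᵢⱼ(∂ₖWᵢⱼ)² = 2|∇ω|²`). Proof: differentiate under `∫_{T^d}`, use the
transport identity for `|ω|²`, drop the transport term `∫ (u·∇)Φ(|ω|²) = 0` (`div u = 0`) and
integrate the viscous term by parts. [cite: Gibbon2010, Appendix A (proof of Prop. 1), opening identity] -/
theorem _root_.Literature.Analysis.FunctionSpaces.Torus.IsClassicalNSSolutionOn.hasDerivWithinAt_integral_comp_torusVorticitySqAt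
    {a b ν : ℝ} {f u : ℝ → UnitAddTorus d → EuclideanSpace ℝ d} {p : ℝ → UnitAddTorus d → ℝ}
    (h : Torus.IsClassicalNSSolutionOn (Icc a b) ν f u p) (hab : a < b) {Φ : ℝ → ℝ} {U : Set ℝ}
    (hUo : IsOpen U) (hΦ : ContDiffOn ℝ ∞ Φ U)
    (hmaps : ∀ s ∈ Icc a b, ∀ x, torusVorticitySqAt (u s) x ∈ U) {t : ℝ} (ht : t ∈ Icc a b) :
    HasDerivWithinAt (fun s => ∫ x, Φ (torusVorticitySqAt (u s) x))
      (2 * (∫ x, deriv Φ (torusVorticitySqAt (u t) x) * torusStretchingDensity (u t) x) -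
        ν * ((∫ x, deriv Φ (torusVorticitySqAt (u t) x) * ∑ k, ∑ i, ∑ j,
              Torus.partialDeriv k (torusVorticityTensor (u t) i j) x ^ 2) +
            ∫ x, deriv (deriv Φ) (torusVorticitySqAt (u t) x) *
              ∑ k, Torus.partialDeriv k (torusVorticitySqAt (u t)) x ^ 2) +
        ∫ x, deriv Φ (torusVorticitySqAt (u t) x) * ∑ i, ∑ j, torusVorticityTensor (u t) i j x *
          (Torus.partialDeriv i (f t) x j - Torus.partialDeriv j (f t) x i))
      (Icc a b) t := by
  set S : Set ℝ := Icc a b with hSdef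
  have hU : UniqueDiffOn ℝ S := uniqueDiffOn_Icc hab
  have hu : Torus.IsSmoothSpaceTimeOn S u := h.smooth_velocity
  have hut : Torus.IsSmooth (u t) := hu.isSmooth_slice ht
  have hdivt : Torus.IsDivFree (u t) := h.divFree t ht
  have hQ : Torus.IsSmooth (torusVorticitySqAt (u t)) := isSmooth_torusVorticitySqAt' hut
  have hW : ∀ i j, Torus.IsSmooth (torusVorticityTensor (u t) i j) :=
    fun i j => isSmooth_torusVorticityTensor'' hut i j
  have hΦ1 : ContDiffOn ℝ ∞ (deriv Φ) U := hΦ.deriv_of_isOpen hUo le_rfl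
  have hG1 : Torus.IsSmooth (fun y => deriv Φ (torusVorticitySqAt (u t) y)) :=
    isSmooth_comp' hΦ1 hQ (hmaps t ht)
  -- the forcing slice is smooth (momentum equation)
  have hf : Torus.IsSmooth (f t) := by
    have hA : Torus.IsSmooth (Torus.timeDerivWithin S u t) := hu.isSmooth_timeDerivWithin hU ht
    have hfun : f t = fun y => Torus.timeDerivWithin S u t y + Torus.convect (u t) (u t) y -
        ν • Torus.laplacian (u t) y + Torus.gradient (p t) y := by
      funext y
      have := h.momentum t ht y
      rw [this]
      abel
    rw [hfun]
    exact ((hA.add (hut.convect hut)).sub (hut.laplacian.smul ν)).add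
      (h.smooth_pressure.isSmooth_slice ht).gradient
  -- Step 1: differentiate under the integral sign
  have hQst : Torus.IsSmoothSpaceTimeOn S (fun s y => torusVorticitySqAt (u s) y) :=
    isSmoothSpaceTimeOn_torusVorticitySqAt' hu hab
  have hΨ : Torus.IsSmoothSpaceTimeOn S (fun s y => Φ (torusVorticitySqAt (u s) y)) :=
    hQst.comp_contDiffOn hΦ hmaps
  have hD := hΨ.hasDerivWithinAt_integral (convex_Icc a b) ht
  refine hD.congr_deriv ?_
  -- Step 2: chain rule in time, pointwise
  have hpt : ∀ x, Torus.timeDerivWithin S (fun s y => Φ (torusVorticitySqAt (u s) y)) t x =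
      deriv Φ (torusVorticitySqAt (u t) x) *
        Torus.timeDerivWithin S (fun s y => torusVorticitySqAt (u s) y) t x := by
    intro x
    have h1 := hQst.hasDerivWithinAt_slice ht x
    have hΦd : HasDerivAt Φ (deriv Φ (torusVorticitySqAt (u t) x)) (torusVorticitySqAt (u t) x) :=
      ((hΦ.differentiableOn (by simp)).differentiableAt (hUo.mem_nhds (hmaps t ht x))).hasDerivAt
    have hc := hΦd.comp_hasDerivWithinAt t h1
    rw [Torus.timeDerivWithin]
    exact hc.derivWithin (hU t ht)
  have hQt : ∀ x, Torus.timeDerivWithin S (fun s y => torusVorticitySqAt (u s) y) t x = _ :=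
    fun x => h.timeDerivWithin_torusVorticitySqAt hab ht x
  simp_rw [hpt, hQt]
  -- Step 3: split the integral
  set G1 : UnitAddTorus d → ℝ := fun y => deriv Φ (torusVorticitySqAt (u t) y) with hG1def
  set σ : UnitAddTorus d → ℝ := torusStretchingDensity (u t) with hσdef
  set A : UnitAddTorus d → ℝ := fun x => ∑ i, ∑ j, torusVorticityTensor (u t) i j x *
    Torus.laplacian (torusVorticityTensor (u t) i j) x with hAdef
  set B : UnitAddTorus d → ℝ := fun x => ∑ i, ∑ j, torusVorticityTensor (u t) i j x *
    (Torus.partialDeriv i (f t) x j - Torus.partialDeriv j (f t) x i) with hBdef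
  set C : UnitAddTorus d → ℝ := fun x => ∑ k, u t x k * ∑ i, ∑ j, torusVorticityTensor (u t) i j x *
    Torus.partialDeriv k (torusVorticityTensor (u t) i j) x with hCdef
  have hσs : Torus.IsSmooth σ := isSmooth_torusStretchingDensity hut
  have hAs : Torus.IsSmooth A := isSmooth_sum₂ fun i j => (hW i j).mul (hW i j).laplacian
  have hBs : Torus.IsSmooth B := isSmooth_sum₂ fun i j =>
    (hW i j).mul (((hf.partialDeriv i).apply j).sub ((hf.partialDeriv j).apply i))
  have hCs : Torus.IsSmooth C := by
    refine isSmooth_sum₁ fun k => ?_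
    have h2 : Torus.IsSmooth (fun x => ∑ i, ∑ j, torusVorticityTensor (u t) i j x *
        Torus.partialDeriv k (torusVorticityTensor (u t) i j) x) :=
      isSmooth_sum₂ fun i j => (hW i j).mul ((hW i j).partialDeriv k)
    exact (hut.apply k).mul h2
  have e1 : ∀ x, G1 x * (2 * σ x + ν * A x + B x - C x) =
      2 * (G1 x * σ x) + ν * (G1 x * A x) + G1 x * B x - G1 x * C x := fun x => by ring
  have sσ : Torus.IsSmooth (fun x => G1 x * σ x) := hG1.mul hσs
  have sA : Torus.IsSmooth (fun x => G1 x * A x) := hG1.mul hAs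
  have sB : Torus.IsSmooth (fun x => G1 x * B x) := hG1.mul hBs
  have sC : Torus.IsSmooth (fun x => G1 x * C x) := hG1.mul hCs
  have iσ : Integrable (fun x => 2 * (G1 x * σ x)) := sσ.integrable.const_mul 2
  have iA : Integrable (fun x => ν * (G1 x * A x)) := sA.integrable.const_mul ν
  have iB : Integrable (fun x => G1 x * B x) := sB.integrable
  have iC : Integrable (fun x => G1 x * C x) := sC.integrable
  have iσA : Integrable (fun x => 2 * (G1 x * σ x) + ν * (G1 x * A x)) := iσ.add iA
  have iσAB : Integrable (fun x => 2 * (G1 x * σ x) + ν * (G1 x * A x) + G1 x * B x) := iσA.add iB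
  have hsplit : ∫ x, G1 x * (2 * σ x + ν * A x + B x - C x) =
      2 * (∫ x, G1 x * σ x) + ν * (∫ x, G1 x * A x) + (∫ x, G1 x * B x) - ∫ x, G1 x * C x := by
    simp_rw [e1]
    rw [integral_sub iσAB iC, integral_add iσA iB, integral_add iσ iA,
      integral_const_mul, integral_const_mul]
  -- Step 4: the transport term vanishes, the viscous term by parts
  have htrans : ∫ x, G1 x * C x = 0 :=
    integral_deriv_comp_mul_convect_torusVorticitySqAt_eq_zero hut hdivt hUo hΦ (hmaps t ht)
  have hvisc := integral_deriv_comp_mul_sum_mul_laplacian_torusVorticityTensor hut hUo hΦ (hmaps t ht)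
  change ∫ x, G1 x * (2 * σ x + ν * A x + B x - C x) = _
  rw [hsplit, htrans]
  change 2 * (∫ x, G1 x * σ x) + ν * (∫ x, G1 x * A x) + (∫ x, G1 x * B x) - 0 =
    2 * (∫ x, G1 x * σ x) - ν * _ + ∫ x, G1 x * B x
  rw [show (∫ x, G1 x * A x) = _ from hvisc]
  ring

end Literature.Analysis.FluidPDE
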